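import Summits.QuantumFields.YangMills.Theorems.LangevinControlUVOSLegsFromFemtoAndGapStubAssemblyLowDegree
import Summits.QuantumFields.YangMills.Theorems.HypercubicLimit.Negative.TruncatedOSForm
import HarnessLib

/-!
# Soft OS-assembly toolkit XI-b: non-triviality and non-Gaussianity of the limit from `LowerBounds`

Helper file for stub `stub_assembly6` of crux `OSLegsFromFemtoAndGap` (stmt-QuantumFields-9367, line
`dlr-collar-transfer`).  Along any sequence of couplings `βₖ → ∞` and tori with `a(βₖ) Lₖ → ∞`, if the centred
lattice two- (three-) point distributions converge on `⁰𝒮` to `S₁ 2` (`S₁ 3`) and `S₁ 1 = 0` (canonical centring),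
then the k-free lattice lower bounds `LowerBounds` (i) / (ii) of the route Defs file give the crux's non-triviality
clause (`twoPointNontrivial_of_lowerBounds`, via the tree's real certificate
`HypercubicLimit.Negative.twoPointNontrivial_of_real` with `u = θv`) and its non-Gaussianity clause
(`nonGaussian_of_lowerBounds`: with `S₁ 1 = 0` the cumulant combination is `S₁ 3 (f ⊗ g ⊗ h)`, and pairwise
disjoint supports put `f ⊗ g ⊗ h` in `⁰𝒮`, `isOffDiagonal_of_disjoint_three`), both for the one-field family
`S₁.toLabelled`.
-/

noncomputable section

open scoped SchwartzMap BigOperators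
open MeasureTheory Filter Topology
open Literature.MathematicalPhysics.QuantumFieldTheory Literature.MathematicalPhysics.QuantumLattice
open Literature.MathematicalPhysics.AQFT
open Literature.Probability.LatticeModels (box Site)
open Summit.QuantumFields.YangMills.Cruxes.OSLegsFromFemtoAndGap.DlrCollarTransfer (Q2 Q3 LowerBounds)
open Summit.QuantumFields.YangMills.Theorems.HypercubicLimit.Negative
  (tensor₁ tensor₂ thetaTensor₁ tensor₂_apply isTensorOf_tensor₂ twoPointNontrivial_of_real
    isOffDiagonal_of_halfSpaces tsupport_thetaTest_neg)

namespace Summit.QuantumFields.YangMills.Theorems.OSLegsFromFemtoAndGap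

local notation "E4" => EuclideanSpace ℝ (Fin 4)

variable {G : Type} [Group G] [TopologicalSpace G] [IsTopologicalGroup G] [CompactSpace G]
  [MeasurableSpace G] [BorelSpace G]

/-! ### Non-triviality -/

/-- **Non-triviality of the limit from `LowerBounds` (i).** -/
theorem twoPointNontrivial_of_lowerBounds (r : LatticeRep G) {a : ℝ → ℝ}
    (hLB : ∃ (v : 𝓢(E4, ℝ)) (ε β₅ Λ₅ : ℝ), tsupport v ⊆ {y : E4 | 0 < y 0} ∧ 0 < ε ∧
      ∀ β : ℝ, β₅ ≤ β → ∀ L : ℕ, Λ₅ ≤ a β * L → ε ≤ Q2 G r β L (a β) (thetaTest 4 v) v)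
    (βs : ℕ → ℝ) (Ls : ℕ → ℕ) (hβ : Tendsto βs atTop atTop)
    (haL : Tendsto (fun k => a (βs k) * Ls k) atTop atTop) (S₁ : SchwingerFamily E4)
    (h1 : ∀ F : 𝓢((Fin 1 → E4), ℂ), S₁ 1 F = 0)
    (hconv : ∀ F : 𝓢((Fin 2 → E4), ℂ), IsOffDiagonal F →
      Tendsto (fun k => latticeDist r.ρ (βs k) (Ls k) (a (βs k)) r.curvature.F
        (wilsonTorusMean r.ρ (βs k) (Ls k) r.curvature.F) 2 F) atTop (𝓝 (S₁ 2 F))) :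
    ∃ (F₁ G₁ : 𝓢((Fin 1 → E4), ℂ)) (H₁ : 𝓢((Fin (1 + 1) → E4), ℂ)),
      IsTimeOrdered F₁ ∧ IsTimeOrdered G₁ ∧ IsAppendTensorOf H₁ (osAdjoint F₁) G₁ ∧
        S₁.toLabelled (1 + 1) (fun _ => ()) H₁ ≠
          S₁.toLabelled 1 (fun _ => ()) (osAdjoint F₁) * S₁.toLabelled 1 (fun _ => ()) G₁ := by
  obtain ⟨v, ε, β₅, Λ₅, hv, hε, hQ⟩ := hLB
  have hu := tsupport_thetaTest_neg hv
  refine twoPointNontrivial_of_real S₁.toLabelled () hu hv ?_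
  simp only [SchwingerFamily.toLabelled_apply, h1, mul_zero]
  -- the two-point value is the limit of `Q2(θv, v) ≥ ε`
  have hT : IsOffDiagonal (tensor₂ (thetaTest 4 v) v) := isOffDiagonal_of_halfSpaces hu hv (isTensorOf_tensor₂ _ _)
  have hlim := hconv (tensor₂ (thetaTest 4 v) v) hT
  have hQ2 : ∀ k, latticeDist r.ρ (βs k) (Ls k) (a (βs k)) r.curvature.F
      (wilsonTorusMean r.ρ (βs k) (Ls k) r.curvature.F) 2 (tensor₂ (thetaTest 4 v) v) =
        (Q2 G r (βs k) (Ls k) (a (βs k)) (thetaTest 4 v) v : ℂ) := fun k =>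
    latticeDist_two_tensor r _ _ _ (thetaTest 4 v) v _ (isTensorOf_tensor₂ _ _)
  have hev : ∀ᶠ k in atTop, ε ≤ Q2 G r (βs k) (Ls k) (a (βs k)) (thetaTest 4 v) v := by
    filter_upwards [hβ.eventually_ge_atTop β₅, haL.eventually_ge_atTop Λ₅] with k hk hkL
    exact hQ _ hk _ hkL
  have hre : Tendsto (fun k => (latticeDist r.ρ (βs k) (Ls k) (a (βs k)) r.curvature.F
      (wilsonTorusMean r.ρ (βs k) (Ls k) r.curvature.F) 2 (tensor₂ (thetaTest 4 v) v)).re) atTop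
      (𝓝 (S₁ 2 (tensor₂ (thetaTest 4 v) v)).re) := (Complex.continuous_re.tendsto _).comp hlim
  have hge : ε ≤ (S₁ 2 (tensor₂ (thetaTest 4 v) v)).re :=
    ge_of_tendsto hre (hev.mono fun k hk => by rw [hQ2 k, Complex.ofReal_re]; exact hk)
  intro h0
  have : (S₁ 2 (tensor₂ (thetaTest 4 v) v)).re = 0 := by
    rw [show S₁ 2 (tensor₂ (thetaTest 4 v) v) = 0 from h0, Complex.zero_re]
  linarith

/-! ### Non-Gaussianity -/

/-- A real three-tensor `f ⊗ g ⊗ h` with pairwise disjoint supports lies in `⁰𝒮`. -/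
theorem isOffDiagonal_of_disjoint_three {f g h : 𝓢(E4, ℝ)} (hfg : Disjoint (tsupport f) (tsupport g))
    (hgh : Disjoint (tsupport g) (tsupport h)) (hfh : Disjoint (tsupport f) (tsupport h))
    {T : 𝓢((Fin 3 → E4), ℂ)} (hT : IsTensorOf T ![ofRealTest f, ofRealTest g, ofRealTest h]) :
    IsOffDiagonal T := by
  apply IsOffDiagonal.of_tsupport_subset
  set K : Set (Fin 3 → E4) := {x | x 0 ∈ tsupport f ∧ x 1 ∈ tsupport g ∧ x 2 ∈ tsupport h} with hK
  have hKc : IsClosed K :=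
    ((isClosed_tsupport _).preimage (continuous_apply 0)).inter
      (((isClosed_tsupport _).preimage (continuous_apply 1)).inter
        ((isClosed_tsupport _).preimage (continuous_apply 2)))
  have hsub : Function.support (T : (Fin 3 → E4) → ℂ) ⊆ K := by
    intro x hx
    rw [Function.mem_support, hT x] at hx
    simp only [Fin.prod_univ_three, Matrix.cons_val_zero, Matrix.cons_val_one, Matrix.cons_val,
      ofRealTest_apply] at hx
    refine ⟨subset_tsupport _ ?_, subset_tsupport _ ?_, subset_tsupport _ ?_⟩
    · intro h0; apply hx; simp [h0]
    · intro h0; apply hx; simp [h0]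
    · intro h0; apply hx; simp [h0]
  refine (closure_minimal hsub hKc).trans ?_
  rintro x ⟨hx0, hx1, hx2⟩ ⟨i, j, hij, hxij⟩
  fin_cases i <;> fin_cases j
  · exact hij rfl
  · exact Set.disjoint_left.1 hfg hx0 (by simpa using hxij ▸ hx1)
  · exact Set.disjoint_left.1 hfh hx0 (by simpa using hxij ▸ hx2)
  · exact Set.disjoint_left.1 hfg (by simpa using hxij ▸ hx0) hx1
  · exact hij rfl
  · exact Set.disjoint_left.1 hgh hx1 (by simpa using hxij ▸ hx2)
  · exact Set.disjoint_left.1 hfh (by simpa using hxij ▸ hx0) hx2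
  · exact Set.disjoint_left.1 hgh (by simpa using hxij ▸ hx1) hx2
  · exact hij rfl

/-- **Non-Gaussianity of the limit from `LowerBounds` (ii).** -/
theorem nonGaussian_of_lowerBounds (r : LatticeRep G) {a : ℝ → ℝ}
    (hLB : ∃ (f g h : 𝓢(E4, ℝ)) (ε β₅ Λ₅ : ℝ), Disjoint (tsupport f) (tsupport g) ∧
      Disjoint (tsupport g) (tsupport h) ∧ Disjoint (tsupport f) (tsupport h) ∧ 0 < ε ∧
      ∀ β : ℝ, β₅ ≤ β → ∀ L : ℕ, Λ₅ ≤ a β * L → ε ≤ |Q3 G r β L (a β) f g h|)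
    (βs : ℕ → ℝ) (Ls : ℕ → ℕ) (hβ : Tendsto βs atTop atTop)
    (haL : Tendsto (fun k => a (βs k) * Ls k) atTop atTop) (S₁ : SchwingerFamily E4)
    (h1 : ∀ F : 𝓢((Fin 1 → E4), ℂ), S₁ 1 F = 0)
    (hconv : ∀ F : 𝓢((Fin 3 → E4), ℂ), IsOffDiagonal F →
      Tendsto (fun k => latticeDist r.ρ (βs k) (Ls k) (a (βs k)) r.curvature.F
        (wilsonTorusMean r.ρ (βs k) (Ls k) r.curvature.F) 3 F) atTop (𝓝 (S₁ 3 F))) :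
    ∃ (f g h : 𝓢(E4, ℂ)) (Ffgh : 𝓢((Fin 3 → E4), ℂ)) (Fgh Ffh Ffg : 𝓢((Fin 2 → E4), ℂ))
      (Ff Fg Fh : 𝓢((Fin 1 → E4), ℂ)),
      IsTensorOf Ffgh ![f, g, h] ∧ IsOffDiagonal Ffgh ∧ IsTensorOf Fgh ![g, h] ∧
      IsTensorOf Ffh ![f, h] ∧ IsTensorOf Ffg ![f, g] ∧ IsTensorOf Ff ![f] ∧ IsTensorOf Fg ![g] ∧
      IsTensorOf Fh ![h] ∧
        S₁.toLabelled 3 (fun _ => ()) Ffgh - S₁.toLabelled 1 (fun _ => ()) Ff * S₁.toLabelled 2 (fun _ => ()) Fgh -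
          S₁.toLabelled 1 (fun _ => ()) Fg * S₁.toLabelled 2 (fun _ => ()) Ffh -
          S₁.toLabelled 1 (fun _ => ()) Fh * S₁.toLabelled 2 (fun _ => ()) Ffg +
          2 * (S₁.toLabelled 1 (fun _ => ()) Ff * S₁.toLabelled 1 (fun _ => ()) Fg *
            S₁.toLabelled 1 (fun _ => ()) Fh) ≠ 0 := by
  obtain ⟨f, g, h, ε, β₅, Λ₅, hfg, hgh, hfh, hε, hQ⟩ := hLB
  set T3 : 𝓢((Fin 3 → E4), ℂ) := SchwartzMap.tensorFin 3 ![ofRealTest f, ofRealTest g, ofRealTest h]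
  have hT3 : IsTensorOf T3 ![ofRealTest f, ofRealTest g, ofRealTest h] := isTensorOf_tensorFin _
  have hT3' : IsTensorOf T3 (fun i => ofRealTest (![f, g, h] i)) := by
    intro x; rw [hT3 x]
    congr 1; funext i; fin_cases i <;> rfl
  have hod : IsOffDiagonal T3 := isOffDiagonal_of_disjoint_three hfg hgh hfh hT3
  refine ⟨ofRealTest f, ofRealTest g, ofRealTest h, T3,
    SchwartzMap.tensorFin 2 ![ofRealTest g, ofRealTest h], SchwartzMap.tensorFin 2 ![ofRealTest f, ofRealTest h],
    SchwartzMap.tensorFin 2 ![ofRealTest f, ofRealTest g], SchwartzMap.tensorFin 1 ![ofRealTest f],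
    SchwartzMap.tensorFin 1 ![ofRealTest g], SchwartzMap.tensorFin 1 ![ofRealTest h], hT3, hod,
    isTensorOf_tensorFin _, isTensorOf_tensorFin _, isTensorOf_tensorFin _, isTensorOf_tensorFin _,
    isTensorOf_tensorFin _, isTensorOf_tensorFin _, ?_⟩
  simp only [SchwingerFamily.toLabelled_apply, h1, zero_mul, sub_zero, mul_zero, add_zero]
  -- `S₁ 3 (f ⊗ g ⊗ h)` is the limit of `Q3(f, g, h)`, `|Q3| ≥ ε`
  have hlim := hconv T3 hod
  have hQ3 : ∀ k, latticeDist r.ρ (βs k) (Ls k) (a (βs k)) r.curvature.F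
      (wilsonTorusMean r.ρ (βs k) (Ls k) r.curvature.F) 3 T3 = (Q3 G r (βs k) (Ls k) (a (βs k)) f g h : ℂ) :=
    fun k => latticeDist_three_tensor r _ _ _ f g h _ hT3'
  have hev : ∀ᶠ k in atTop, ε ≤ |Q3 G r (βs k) (Ls k) (a (βs k)) f g h| := by
    filter_upwards [hβ.eventually_ge_atTop β₅, haL.eventually_ge_atTop Λ₅] with k hk hkL
    exact hQ _ hk _ hkL
  have hnorm : Tendsto (fun k => ‖latticeDist r.ρ (βs k) (Ls k) (a (βs k)) r.curvature.F
      (wilsonTorusMean r.ρ (βs k) (Ls k) r.curvature.F) 3 T3‖) atTop (𝓝 ‖S₁ 3 T3‖) :=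
    (continuous_norm.tendsto _).comp hlim
  have hge : ε ≤ ‖S₁ 3 T3‖ :=
    ge_of_tendsto hnorm (hev.mono fun k hk => by rw [hQ3 k, Complex.norm_real, Real.norm_eq_abs]; exact hk)
  intro h0
  rw [h0, norm_zero] at hge
  linarith

end Summit.QuantumFields.YangMills.Theorems.OSLegsFromFemtoAndGap

end
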